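import Summits.QuantumAdvantage.QuantumAdvantage.Theorems.CharDialTableDialB
import HarnessLib

/-!
# CharDialStrataDialA — tree twin (part A: §1 density, §2 glue) of the decomp-qadv lens-5 g31 node «StrataDial» on `CharDial.FrobStructureLawOdd` (stmt-QuantumAdvantage-27205)

Lens 5 «finite/base range + asymptotic regime + bridge», third turn of the dial inside piece E (`IslandDial.ExchCoreOdd`) of the
g28 split `T ↔ ExchCoreOdd ∧ IslandOdd`.  g29 split `E(p)` EXACTLY into a finite range B (`LevelDial.BaseAt`) and a glue G
(`LevelDial.GlueAt`); g30 split B EXACTLY (modulo G) into a TABLE CORE (`TableDial.TabAt`: finite, level-free, instrument-certified at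
`p = 5, 7`) and a SEED (`TableDial.SeedAt`), leaving `T ↔ SeedOdd ∧ TabOdd ∧ GlueOdd ∧ IslandOdd` with «Seed» IDEA-NEEDED and «Glue»
UNDECIDED at every prime.  THIS NODE PROVES TWO OF THE FOUR PIECES, for every prime, in the kernel:
  (A) `glueAt_holds : GlueAt p`  (hence `glueOdd_holds : GlueOdd`);
  (B) `seedAt_of_tabAt : TabAt p → SeedAt p`  (indeed the seed at EVERY large level: `seed_from_of_tabAt`).
Hence `exchCoreAt_iff_tabAt : ExchCoreAt p ↔ TabAt p` — PIECE E IS EXACTLY THE FINITE, LEVEL-FREE TABLE CORE — and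
`target_iff : FrobStructureLawOdd ↔ TabOdd ∧ IslandOdd`.  g30's located residual of `E(7)` («`GlueAt 7` ∧ one seed level `≥ 14`») is
DISCHARGED: `exchCoreAt_seven_of_core : TabLaw 7 4 9 → ExchCoreAt 7` and `exchCoreAt_five_of_core : TabLaw 5 1 3 → ExchCoreAt 5`, so
`E(5)`, `E(7)` rest on the instrument-certified table cores alone (census K41 A3 / lens-6 CENSUS-I2; g30 `check/tabcheck.c`), and with the
island `lawAt_of_core_island : TabLaw p K (2K+1) → IslandAt p → (law 2½ at p)`.

THE NEW LEVER (★ `density`, §1): NON-EXCHANGEABILITY IS DENSE ACROSS SLICES (Schwartz–Zippel on the cube).  If `f` has 𝔽_p-degree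
`≤ p − 1` and is NOT invariant under a transposition `(i j)`, `i ≠ j ∈ B`, then at least `2^{n−(p−1)}` of the `2^n` slices
`u ↦ f (merge B u x)` are not `(i j)`-invariant: `D(x) = 1_f(x; i↦0, j↦1) − 1_f(x; i↦1, j↦0)` is a difference of two restrictions, so
`D ∈ lowDeg(p−1)` (tree `SubLog.restr_mem_lowDeg`), `D ≠ 0`, so `D` has `≥ 2^{n−(p−1)}` non-zeros (tree `SubLog.card_support_ge_of_mem_lowDeg`),
and at each non-zero `x` the slice over `x` takes different values at two `(i j)`-mirror points.  SLICES VOTE (`exch_of_slices`): if EVERY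
slice over `B` is exchangeable off `≤ K` coordinates of `B`, double counting (moved pair, slice) incidences bounds the moved pairs of `f`
in `B` by `2^p K |B|`; a coordinate of minimal cross-degree has `≤ 2^p K` non-partners, and its partners are pairwise exchangeable
(tree `SubChar.swapInv_conj`): `f` is exchangeable off `≤ 2^p K` coordinates of `B`.  (A) is `exch_of_slices` read on g29's glue
hypothesis («every outside-slice is exchangeable off `≤ K` inside `X`»), with `E = 2^p K`; the top-layer hypothesis is not even used.

THE DIAL (§4, `Flat p f X ℓ`): the FLATNESS DEPTH `ℓ` of the mod-`p` Möbius table `χ_f(T) = μ_T(1_f)` (`chi`) — the top `ℓ` strata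
`k = p − ℓ, …, p − 1` are constant on the `k`-subsets of `X`; `ℓ = 1` is the class hypothesis `TopConst`, `ℓ = p − 1` is full symmetry.
* FINITE RANGE (`ℓ = p − 1`, `flatSeed_base`): all strata constant ⟹ `f` exchangeable on ALL of `X`, by the EXCHANGEABILITY CRITERION
  `swapInv_of_chi` / `swapInv_of_moeb_insert` (Möbius inversion `SubLog.sum_moeb_powerset` at the two mirror points `u`, `u ∘ (i j)`:
  `χ(S ∪ i) = χ(S ∪ j)` for `S ⊆ X ∖ {i, j}`, `|S| ≤ p − 2` forces `(i j)`-invariance; larger or outside `S` give `0 = 0` by degree /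
  `DependsOn`).
* ASYMPTOTIC REGIME = THE LADDER STEP (`flatSeed_step`, every depth, kernel): flat seed at depth `ℓ + 1` ∧ the table law at every co-size
  ⟹ flat seed at depth `ℓ`.  Ramsey with colours `𝔽_p` (tree `SubChar.ramsey_finite_colours`) makes stratum `p − 1 − ℓ` constant on a
  window `B ⊆ X`; the SLICE FORMULA `chi_slice : χ_{f|B,x}(T) = Σ_{U ⊆ ones(x) ∖ B} χ_f(T ∪ U)` (`T ⊆ B`; from `moeb_restr_sum`) shows EVERY
  slice over `B` is `(ℓ+1)`-flat on `B` (the strata of `f` above `p − 1 − ℓ` are constant on `X` and vanish above `p − 1` and off `X`);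
  depth `ℓ + 1` gives each slice a `(p−1)`-block, the table law (`TableDial.tabLaw_all_of_core`) makes each slice exchangeable off `≤ K`
  in `B`, and SLICES VOTE transfers this to `f` itself: a block in `B` of size `≥ |B| − 2^p K ≥ p − 1`.
* BRIDGE (`flatSeed_all`, `seed_from_of_tabAt`): induction on the depth from `p − 1` down to `1` = the plain seed `SeedLevel p m` at EVERY
  level `m ≥ m₀(p, K)` (a Ramsey tower); so g30's bridge `baseAt_of_seed_tab` now bites from the table core ALONE (`baseAt_of_tabAt`).
* HOW FAR THE FINITE RANGE MUST REACH: unchanged from g30 — the table core at co-size `2K₀(p) + 1` (`= 9` at `p = 7`, `= 3` at `p = 5`);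
  NOTHING ELSE of piece E is left at any prime.

PIECES (BY NAME against the tree): `closes : TableDial.TabOdd → IslandDial.IslandOdd → CharDial.FrobStructureLawOdd`; EXACT:
`target_iff : FrobStructureLawOdd ↔ TabOdd ∧ IslandOdd`; per prime `exchCoreAt_iff_tabAt`, `baseAt_of_tabAt`, `fewAt_of_tabAt`,
`pieces_of_tab : TabOdd → SeedOdd ∧ TabOdd ∧ GlueOdd` (the g30 four-piece split collapses onto «Tab»).

No `sorry`, no new axioms, no instances, no notation; imports only the tree (`Theorems.CharDialTableDialB`) and `HarnessLib`.
-/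

set_option autoImplicit false
set_option linter.dupNamespace false

namespace Summit.QuantumAdvantage.QuantumAdvantage.Theorems.StrataDial

open Finset
open Summit.QuantumAdvantage.AdviceFreeQNC0
open Literature.Computability.MetaComplexity Literature.Computability.MetaComplexity.Smolensky
open Summit.QuantumAdvantage.QuantumAdvantage.Theorems.IslandDial (Exch TopConst ExchCoreAt ExchCoreOdd IslandAt IslandOdd
  NormalForm lawAt_of_pieces)
open Summit.QuantumAdvantage.QuantumAdvantage.Theorems.LevelDial (RPrimeAt nB BaseAt BaseOdd TailAt GlueAt GlueOdd
  depOn_slice hasDegF_slice topConst_slice exch_mono)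
open Summit.QuantumAdvantage.QuantumAdvantage.Theorems.TableDial (TabLaw TabAt TabOdd SeedLevel SeedAt SeedOdd FewAt FewOdd
  tabLaw_all_of_core tabAt_iff_all exchCoreAt_of_seed_tab_glue tabAt_of_exchCoreAt fewAt_of_exchCoreAt)

/-! ### §1 Non-exchangeability is dense across slices -/

section Density

variable {p : ℕ} [hp : Fact p.Prime] {n : ℕ}

/-- `f` is invariant under the transposition `(i j)`. -/
def SwapInv (f : (Fin n → Bool) → Bool) (i j : Fin n) : Prop := ∀ u : Fin n → Bool, f (u ∘ Equiv.swap i j) = f u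

/-- A point with equal `i`- and `j`-coordinates is fixed by the transposition. -/
theorem comp_swap_eq_self {u : Fin n → Bool} {i j : Fin n} (h : u i = u j) : u ∘ Equiv.swap i j = u := by
  funext k
  show u (Equiv.swap i j k) = u k
  by_cases hki : k = i
  · rw [hki, Equiv.swap_apply_left, h]
  · by_cases hkj : k = j
    · rw [hkj, Equiv.swap_apply_right, h]
    · rw [Equiv.swap_apply_of_ne_of_ne hki hkj]

/-- The two test points of a transposition: `x` with `(x_i, x_j)` set to `(a, b)`. -/
def setPair (x : Fin n → Bool) (i j : Fin n) (a b : Bool) : Fin n → Bool :=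
  Function.update (Function.update x i a) j b

/-- Coordinates of `setPair`. -/
theorem setPair_apply {i j : Fin n} (hij : i ≠ j) (x : Fin n → Bool) (a b : Bool) (k : Fin n) :
    setPair x i j a b k = if k = i then a else if k = j then b else x k := by
  unfold setPair
  by_cases hki : k = i
  · subst hki
    rw [Function.update_of_ne hij, Function.update_self, if_pos rfl]
  · rw [if_neg hki]
    by_cases hkj : k = j
    · subst hkj
      rw [Function.update_self, if_pos rfl]
    · rw [Function.update_of_ne hkj, Function.update_of_ne hki, if_neg hkj]

/-- The transposition `(i j)` exchanges the two test points. -/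
theorem setPair_comp_swap {i j : Fin n} (hij : i ≠ j) (x : Fin n → Bool) (a b : Bool) :
    setPair x i j a b ∘ Equiv.swap i j = setPair x i j b a := by
  funext k
  show setPair x i j a b (Equiv.swap i j k) = setPair x i j b a k
  rw [setPair_apply hij, setPair_apply hij]
  by_cases hki : k = i
  · subst hki
    rw [Equiv.swap_apply_left, if_neg (Ne.symm hij), if_pos rfl, if_pos rfl]
  · by_cases hkj : k = j
    · subst hkj
      rw [Equiv.swap_apply_right, if_pos rfl, if_neg hki, if_pos rfl]
    · rw [Equiv.swap_apply_of_ne_of_ne hki hkj, if_neg hki, if_neg hkj, if_neg hki, if_neg hkj]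

/-- `setPair` is a restriction in the sense of `SubLog.restr` (freeze `i, j`). -/
theorem setPair_eq_merge {i j : Fin n} (hij : i ≠ j) (x : Fin n → Bool) (a b : Bool) :
    setPair x i j a b = SubLog.merge ((Finset.univ.erase i).erase j) x (setPair (fun _ => false) i j a b) := by
  funext k
  unfold SubLog.merge
  rw [setPair_apply hij, setPair_apply hij]
  by_cases hki : k = i
  · subst hki
    rw [if_pos rfl, if_neg (by simp), if_pos rfl]
  · by_cases hkj : k = j
    · subst hkj
      rw [if_neg hki, if_pos rfl, if_neg (by simp), if_neg hki, if_pos rfl]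
    · rw [if_neg hki, if_neg hkj, if_pos (by simp [hki, hkj])]

/-- A slice over `B ∋ i, j` evaluated at a test point of `x` is `f` at that test point. -/
theorem slice_setPair (f : (Fin n → Bool) → Bool) {B : Finset (Fin n)} {i j : Fin n} (hij : i ≠ j) (hi : i ∈ B) (hj : j ∈ B)
    (x : Fin n → Bool) (a b : Bool) : f (SubLog.merge B (setPair x i j a b) x) = f (setPair x i j a b) := by
  congr 1
  funext k
  unfold SubLog.merge
  by_cases hkB : k ∈ B
  · rw [if_pos hkB]
  · rw [if_neg hkB, setPair_apply hij]
    have hki : k ≠ i := fun h => hkB (h ▸ hi)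
    have hkj : k ≠ j := fun h => hkB (h ▸ hj)
    rw [if_neg hki, if_neg hkj]

/-- **DENSITY LEMMA.**  If `f` (`𝔽_p`-degree `≤ p − 1`) is NOT invariant under the transposition `(i j)`, `i, j ∈ B`, then
at least `2^{n−(p−1)}` of the `2^n` slices `u ↦ f (merge B u x)` over `B` are not invariant under it either
(Schwartz–Zippel on the cube, `SubLog.card_support_ge_of_mem_lowDeg`, applied to `x ↦ 1_f(x; i↦0, j↦1) − 1_f(x; i↦1, j↦0)`). -/
theorem density {f : (Fin n → Bool) → Bool} (hf : HasDegF p f (p - 1)) {B : Finset (Fin n)} {i j : Fin n}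
    (hi : i ∈ B) (hj : j ∈ B) (h : ¬ SwapInv f i j)
    [DecidablePred fun x : Fin n → Bool => ¬ SwapInv (fun u => f (SubLog.merge B u x)) i j] :
    2 ^ (n - (p - 1)) ≤ (Finset.univ.filter fun x : Fin n → Bool => ¬ SwapInv (fun u => f (SubLog.merge B u x)) i j).card := by
  classical
  have hij : i ≠ j := by
    rintro rfl
    exact h (SubChar.swapInv_self f i)
  set G : CubeFn (ZMod p) n := SubLog.indR (ZMod p) f with hGdef
  set S : Finset (Fin n) := (Finset.univ.erase i).erase j with hS
  set D : CubeFn (ZMod p) n := SubLog.restr S (setPair (fun _ => false) i j false true) G -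
    SubLog.restr S (setPair (fun _ => false) i j true false) G with hDdef
  have hG : G ∈ lowDeg (ZMod p) n (p - 1) := (SubLog.hasDegF_iff_indR p f (p - 1)).1 hf
  have hD : D ∈ lowDeg (ZMod p) n (p - 1) :=
    Submodule.sub_mem _ (SubLog.restr_mem_lowDeg S _ hG) (SubLog.restr_mem_lowDeg S _ hG)
  have hDx : ∀ x : Fin n → Bool, D x = G (setPair x i j false true) - G (setPair x i j true false) := by
    intro x
    show G (SubLog.merge S x _) - G (SubLog.merge S x _) = _
    rw [← setPair_eq_merge hij, ← setPair_eq_merge hij]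
  have hGne : ∀ u v : Fin n → Bool, f u ≠ f v → G u ≠ G v := by
    intro u v huv hG'
    apply huv
    simp only [hGdef, SubLog.indR] at hG'
    cases hu : f u <;> cases hv : f v <;> simp_all
  -- `D ≠ 0`
  obtain ⟨u, hu⟩ : ∃ u : Fin n → Bool, f (u ∘ Equiv.swap i j) ≠ f u := not_forall.1 h
  have huij : u i ≠ u j := fun heq => hu (by rw [comp_swap_eq_self heq])
  have hDne : D ≠ 0 := by
    intro hD0
    have key : D u = 0 := by rw [hD0]; rfl
    rw [hDx] at key
    cases hui : u i
    · -- `u = setPair u i j false true`, `u ∘ swap = setPair u i j true false`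
      have huj : u j = true := by
        cases huj : u j
        · exact absurd (hui.trans huj.symm) huij
        · rfl
      have e1 : setPair u i j false true = u := by
        funext k; rw [setPair_apply hij]
        by_cases hki : k = i
        · rw [if_pos hki, hki, hui]
        · rw [if_neg hki]
          by_cases hkj : k = j
          · rw [if_pos hkj, hkj, huj]
          · rw [if_neg hkj]
      have e2 : setPair u i j true false = u ∘ Equiv.swap i j := by
        rw [← setPair_comp_swap hij, e1]
      rw [e1, e2] at key
      exact hGne _ _ (Ne.symm hu) (sub_eq_zero.1 key)
    · have huj : u j = false := by
        cases huj : u j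
        · rfl
        · exact absurd (hui.trans huj.symm) huij
      have e1 : setPair u i j true false = u := by
        funext k; rw [setPair_apply hij]
        by_cases hki : k = i
        · rw [if_pos hki, hki, hui]
        · rw [if_neg hki]
          by_cases hkj : k = j
          · rw [if_pos hkj, hkj, huj]
          · rw [if_neg hkj]
      have e2 : setPair u i j false true = u ∘ Equiv.swap i j := by
        rw [← setPair_comp_swap hij, e1]
      rw [e1, e2] at key
      exact hGne _ _ hu (sub_eq_zero.1 key)
  refine (SubLog.card_support_ge_of_mem_lowDeg hD hDne).trans (Finset.card_le_card fun x hx => ?_)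
  rw [Finset.mem_filter] at hx ⊢
  refine ⟨Finset.mem_univ _, fun hinv => hx.2 ?_⟩
  have h1 : f (SubLog.merge B (setPair x i j false true ∘ Equiv.swap i j) x) = f (SubLog.merge B (setPair x i j false true) x) :=
    hinv (setPair x i j false true)
  rw [setPair_comp_swap hij, slice_setPair f hij hi hj, slice_setPair f hij hi hj] at h1
  rw [hDx, sub_eq_zero]
  simp only [hGdef, SubLog.indR, h1]

/-- **SLICES VOTE.**  If EVERY slice of `f` over `B` is exchangeable off `≤ K` coordinates of `B`, then `f` is exchangeable off
`≤ 2^p · K` coordinates of `B` (density lemma + double counting of (pair, slice) incidences + a coordinate of minimal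
cross-degree, whose exchange partners form the block by conjugation `SubChar.swapInv_conj`). -/
theorem exch_of_slices {f : (Fin n → Bool) → Bool} (hf : HasDegF p f (p - 1)) (B : Finset (Fin n)) {K : ℕ}
    (hK : ∀ x : Fin n → Bool, ∃ Y : Finset (Fin n), Y ⊆ B ∧ B.card ≤ Y.card + K ∧ Exch (fun u => f (SubLog.merge B u x)) Y) :
    ∃ R : Finset (Fin n), R ⊆ B ∧ B.card ≤ R.card + 2 ^ p * K ∧ Exch f R := by
  classical
  set T : Finset (Fin n × Fin n) := (B ×ˢ B).filter fun q => ¬ SwapInv f q.1 q.2 with hT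
  have step1 : T.card * 2 ^ (n - (p - 1)) ≤ 2 ^ n * (2 * K * B.card) := by
    have lhs : T.card * 2 ^ (n - (p - 1)) ≤
        ∑ q ∈ T, (Finset.univ.filter fun x : Fin n → Bool => ¬ SwapInv (fun u => f (SubLog.merge B u x)) q.1 q.2).card := by
      rw [← smul_eq_mul, ← Finset.sum_const]
      refine Finset.sum_le_sum fun q hq => ?_
      obtain ⟨hqB, hq'⟩ := Finset.mem_filter.1 hq
      obtain ⟨h1, h2⟩ := Finset.mem_product.1 hqB
      exact density hf h1 h2 hq'
    have hswap : ∑ q ∈ T, (Finset.univ.filter fun x : Fin n → Bool => ¬ SwapInv (fun u => f (SubLog.merge B u x)) q.1 q.2).card =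
        ∑ x : Fin n → Bool, (T.filter fun q => ¬ SwapInv (fun u => f (SubLog.merge B u x)) q.1 q.2).card := by
      simp only [Finset.card_filter]
      exact Finset.sum_comm
    have rhs : ∀ x : Fin n → Bool, (T.filter fun q => ¬ SwapInv (fun u => f (SubLog.merge B u x)) q.1 q.2).card ≤ 2 * K * B.card := by
      intro x
      obtain ⟨Y, hYB, hYc, hYex⟩ := hK x
      have hsub : (T.filter fun q => ¬ SwapInv (fun u => f (SubLog.merge B u x)) q.1 q.2) ⊆ (B ×ˢ B) \ (Y ×ˢ Y) := by
        intro q hq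
        rw [Finset.mem_filter] at hq
        rw [Finset.mem_sdiff]
        refine ⟨(Finset.mem_filter.1 hq.1).1, fun hqY => hq.2 ?_⟩
        obtain ⟨hy1, hy2⟩ := Finset.mem_product.1 hqY
        exact hYex q.1 hy1 q.2 hy2
      refine (Finset.card_le_card hsub).trans ?_
      have hYY : Y ×ˢ Y ⊆ B ×ˢ B := Finset.product_subset_product hYB hYB
      have hcs : ((B ×ˢ B) \ (Y ×ˢ Y)).card = (B ×ˢ B).card - (Y ×ˢ Y).card := Finset.card_sdiff_of_subset hYY
      rw [hcs, Finset.card_product, Finset.card_product]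
      have hYle : Y.card ≤ B.card := Finset.card_le_card hYB
      apply Nat.sub_le_iff_le_add.2
      nlinarith [hYc, hYle]
    calc T.card * 2 ^ (n - (p - 1))
        ≤ ∑ q ∈ T, (Finset.univ.filter fun x : Fin n → Bool => ¬ SwapInv (fun u => f (SubLog.merge B u x)) q.1 q.2).card := lhs
      _ = ∑ x : Fin n → Bool, (T.filter fun q => ¬ SwapInv (fun u => f (SubLog.merge B u x)) q.1 q.2).card := hswap
      _ ≤ ∑ _x : Fin n → Bool, 2 * K * B.card := Finset.sum_le_sum fun x _ => rhs x
      _ = 2 ^ n * (2 * K * B.card) := by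
          rw [Finset.sum_const, smul_eq_mul, Finset.card_univ, Fintype.card_fun, Fintype.card_bool, Fintype.card_fin]
  have step2 : T.card ≤ 2 ^ p * K * B.card := by
    have h2 : 2 ^ n ≤ 2 ^ (n - (p - 1)) * 2 ^ (p - 1) := by
      rw [← pow_add]
      exact Nat.pow_le_pow_right (by norm_num) (by omega)
    have hp1 : 2 ^ (p - 1) * 2 = 2 ^ p := by
      rw [← pow_succ]
      congr 1
      have := hp.out.one_lt
      omega
    have h3 : T.card * 2 ^ n ≤ (2 ^ p * K * B.card) * 2 ^ n :=
      calc T.card * 2 ^ n ≤ T.card * (2 ^ (n - (p - 1)) * 2 ^ (p - 1)) := Nat.mul_le_mul_left _ h2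
        _ = (T.card * 2 ^ (n - (p - 1))) * 2 ^ (p - 1) := by ring
        _ ≤ (2 ^ n * (2 * K * B.card)) * 2 ^ (p - 1) := Nat.mul_le_mul_right _ step1
        _ = (2 ^ p * K * B.card) * 2 ^ n := by rw [← hp1]; ring
    exact Nat.le_of_mul_le_mul_right h3 (by positivity)
  by_cases hB : B = ∅
  · refine ⟨∅, by simp, by simp [hB], fun i hi => absurd hi (by simp)⟩
  have hBne : B.Nonempty := Finset.nonempty_iff_ne_empty.2 hB
  obtain ⟨i₀, hi₀B, hi₀⟩ : ∃ i₀ ∈ B, (B.filter fun j => ¬ SwapInv f i₀ j).card * B.card ≤ T.card := by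
    have hsum : ∑ i ∈ B, (B.filter fun j => ¬ SwapInv f i j).card = T.card := by
      rw [hT, Finset.card_filter, Finset.sum_product]
      simp only [Finset.card_filter]
    have hle : ∑ i ∈ B, (B.filter fun j => ¬ SwapInv f i j).card * B.card ≤ ∑ _i ∈ B, T.card := by
      rw [← Finset.sum_mul, hsum, Finset.sum_const, smul_eq_mul, mul_comm]
    exact Finset.exists_le_of_sum_le hBne hle
  have hN : (B.filter fun j => ¬ SwapInv f i₀ j).card ≤ 2 ^ p * K :=
    Nat.le_of_mul_le_mul_right (hi₀.trans step2) (Finset.card_pos.2 hBne)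
  refine ⟨B.filter fun j => SwapInv f i₀ j, Finset.filter_subset _ _, ?_, fun a ha b hb u => ?_⟩
  · have := Finset.card_filter_add_card_filter_not (s := B) (fun j => SwapInv f i₀ j)
    omega
  · exact SubChar.swapInv_conj f (Finset.mem_filter.1 ha).2 (Finset.mem_filter.1 hb).2 u

end Density

/-! ### §2 Piece G of g29/g30 is a theorem -/

/-- **GLUE HOLDS** at every prime: lens-6's conjecture (G) «glue across outside slices» (= `LevelDial.GlueAt p`, piece G of the g29
split `ExchCoreAt p ↔ BaseAt p ∧ GlueAt p` and of the g30 split) with the explicit budget `E = 2^p · K`.  The top-layer hypothesis is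
not even used. -/
theorem glueAt_holds (p : ℕ) [Fact p.Prime] : GlueAt p := fun K =>
  ⟨2 ^ p * K, fun _n _f X hf _ hσ => exch_of_slices hf X hσ⟩

/-- Piece G over the odd primes. -/
theorem glueOdd_holds : GlueOdd := fun p _ _ => glueAt_holds p

end Summit.QuantumAdvantage.QuantumAdvantage.Theorems.StrataDial
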